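import Summits.QuantumFields.YangMills.Theorems.UnitScaleTiltCoverDomains
import Summits.QuantumFields.YangMills.Theorems.UnitScaleTiltProp8FlatRowsWholeClosed
import HarnessLib

/-!
# Route `UnitScaleTilt`, crux K1 «MinimiserStabilityRegPr» (stmt-QuantumFields-19200), leaf `stub_halvingStep` — the (P2-small) branch by COVERING
# (★★OWNER RULINGS g26-№18 (α) ∕ ACK 30, brick α5): **THE P2 LETTERS DESCEND FROM THE `L^{jc}`-FOLD COVER TO THE SMALL MEMBER**

Cell `ym3-torus` (HUMAN RULING D-0037, YM ladder rung R3 — continuum SU(2) YM₃ on the torus is a RUNG, not the Clay problem), explicit-unit helper seat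
`ym-ust-19200-w4` gen 3, row α5 of RULING g26-№18 (C) (re-assigned by ACK 30), typed from LEAD `ym-ust-19200-w5` g3's plan `H-SMALL-PLAN-w5g3.md` §3 «LETTER TRANSFER»
against ✓α1 `…CoverSites` (★w8-19936 g0) and ✓α2 `…CoverDomains` (★w1-20520 g5) BY NAME.  Def-free; `--supports stmt-QuantumFields-19200 --as helper`; counts toward nothing by itself.

THE MECHANISM (plan §3).  A member `(m, n, K)` below the V1L0 port's torus-size floor is LIFTED to its cover `(m + jc, n, K)`: `π = proj`, `D̃ = D.comap jc`,
`w̃ m b̃ = w m (π b̃)` (`isLevWeight_comap`).  The P2 body holds UPSTAIRS for the canonical operators `H̃, G̃t`; the key lemma of the branch (α4, NOT used here — it enters as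
the HYPOTHESES `hH`, `hGt`, and for the one non-shift stencil row `hdd`) says they are the periodisations of the downstairs ones: `H̃ (X ∘ π) = (H X) ∘ π`, `G̃t (f ∘ π) = (Gt f) ∘ π`.
Reading the upstairs letters on periodic data at a lift of the downstairs bond gives the downstairs letters:
* §1 tools: a fixed lift `liftBond`, the FIBRE-MINIMAL distance `dBImin dBĨ b c := min_{c̃ ∈ π⁻¹c} dBĨ (liftBond b) c̃` (attained: `exists_dBImin_eq`; dominates `distBI D`:
  `distBI_le_dBImin`, by ✓`distBI_proj_le`), the fibre decay bound `Σ_{c̃} e^{−δ₀dBĨ(b̃,c̃)}|X(π c̃)| ≤ (L^{jc})^d · Σ_c e^{−δ₀·dBImin(b,c)}|X c|` (`sum_fibre_decay_le`, by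
  ✓`sum_idx_cover_eq_sum_fibre` + ✓`card_fibre_idx`).
* §2 ★ the three SUP letters descend VERBATIM (same `B₀`): `hSupLetterG_of_cover`, `gtSupLetterG_of_cover`, `gtLaplaceLetterG_of_cover` (the level-weighted sup of `X ∘ π`
  is that of `X`; shifts commute with `π`, ✓`proj_shift`∕`proj_unshift`).
* §3 ★★ `hDecayLetterD_of_cover`: the four (161)₁ rows descend with `dBI := dBImin`, SAME `δ₀`, `B₀ ↦ B₀·(L^{jc})^d` (the fibre of an index bond has `(L^{jc})^d` elements,
  K-FREE — plan kill test k-iv); ★★ `rowSum162_of_cover`: (162) descends with the SAME `B₃` (each downstairs summand is ONE upstairs summand — the minimising lift — and all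
  summands are `≥ 0`, ✓`le_sum_fibre_of_nonneg`); ★★★ `lettersMS_of_cover`: the `FlatOpsAdmAtMS`-shaped letter package downstairs with the single constant `B₀·(L^{jc})^d`
  (`hSupLetterG_mono` & co. raise the sup letters' `B₀`; guarded letters are monotone in `B₀`).
HONEST SCOPE: finite sums and `Real.exp` monotonicity; no operator theory (that is α3∕α4); nothing of print is asserted; NOT a claim about the stub, the crux or the gap.

References: T. Bałaban, CMP **102** (1985) 277–309 [Balaban1985Variational] ((46) p.285, (161)–(162) p.303, (165) p.304); CMP **96** (1984) 223–250
[Balaban1984PropagatorsII] ((2.3) p.224, Cor. 2.8 (2.150)–(2.151) p.249 — the estimates are uniform in the volume); CMP **109** (1987) 249–301 [Balaban1987RG1] ((0.1) p.251).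
-/

open scoped BigOperators

noncomputable section

namespace Summit.QuantumFields.YangMills.Theorems.CoverLetters

open Literature.MathematicalPhysics.QuantumFieldTheory.Balaban1983to89
open B6SectADomainsV1 (Domains)
open B6SectAOperatorsV1 (BondIdx dcE dcsE)
open T3ContinuumYM3Torus (T3Family)
open FlatCubeOpsText (distBI IsLevWeight HSupLetterG GtSupLetterG GtLaplaceLetterG HDecayLetterD RowSum162)
open CoverSites (cover proj projBond projBond_src projBond_dir proj_shift proj_unshift projBond_surjective)
open CoverDomains (projIdx projIdx_level projIdx_surjective card_fibre_idx sum_idx_cover_eq_sum_fibre le_sum_fibre_of_nonneg distBI_proj_le isLevWeight_comap)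

/-! ## §1 Tools: a fixed lift, the fibre-minimal distance, the fibre decay bound -/

section Tools

variable {P : Params} (D : Domains P) (jc : ℕ)

/-- a fixed lift of every fine bond (any section of `projBond`). [cite: Balaban1984PropagatorsII, (2.3) p.224] -/
def liftBond (b : PBond P 0) : PBond (cover P jc) 0 := Classical.choose (projBond_surjective P jc 0 b)

/-- `liftBond` is a section of `π`. [cite: Balaban1984PropagatorsII, (2.3) p.224] -/
theorem projBond_liftBond (b : PBond P 0) : projBond P jc 0 (liftBond jc b) = b := Classical.choose_spec (projBond_surjective P jc 0 b)

/-- the fibre of an index bond under `projIdx`, as a `Finset`. [cite: Balaban1984PropagatorsII, (2.3) p.224] -/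
def fibreIdx [DecidableEq (BondIdx D)] (c : BondIdx D) : Finset (BondIdx (D.comap jc)) := Finset.univ.filter fun ct => projIdx D jc ct = c

/-- membership in the fibre. [cite: Balaban1984PropagatorsII, (2.3) p.224] -/
theorem mem_fibreIdx [DecidableEq (BondIdx D)] {c : BondIdx D} {ct : BondIdx (D.comap jc)} : ct ∈ fibreIdx D jc c ↔ projIdx D jc ct = c := by
  unfold fibreIdx
  rw [Finset.mem_filter]
  exact ⟨fun h => h.2, fun h => ⟨Finset.mem_univ _, h⟩⟩

/-- the fibre is nonempty (`projIdx` is onto). [cite: Balaban1984PropagatorsII, (2.3) p.224] -/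
theorem fibreIdx_nonempty [DecidableEq (BondIdx D)] (c : BondIdx D) : (fibreIdx D jc c).Nonempty := by
  obtain ⟨ct, hct⟩ := projIdx_surjective D jc c
  exact ⟨ct, (mem_fibreIdx D jc).2 hct⟩

/-- **THE FIBRE-MINIMAL DISTANCE** `dBImin(b, c) := min_{c̃ ∈ π⁻¹c} dBĨ(b̃₀, c̃)` at the fixed lift `b̃₀ = liftBond b` — the admissible `dBI` of the small member
(plan §3: `dBI_small`). [cite: Balaban1985Variational, (161) p.303] -/
def dBImin [DecidableEq (BondIdx D)] (dBIt : PBond (cover P jc) 0 → BondIdx (D.comap jc) → ℝ) (b : PBond P 0) (c : BondIdx D) : ℝ :=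
  (fibreIdx D jc c).inf' (fibreIdx_nonempty D jc c) fun ct => dBIt (liftBond jc b) ct

/-- `dBImin ≤ dBĨ` on the fibre. [cite: Balaban1985Variational, (161) p.303] -/
theorem dBImin_le [DecidableEq (BondIdx D)] (dBIt : PBond (cover P jc) 0 → BondIdx (D.comap jc) → ℝ) (b : PBond P 0) (ct : BondIdx (D.comap jc)) :
    dBImin D jc dBIt b (projIdx D jc ct) ≤ dBIt (liftBond jc b) ct := by
  unfold dBImin
  exact Finset.inf'_le (fun ct' => dBIt (liftBond jc b) ct') ((mem_fibreIdx D jc).2 rfl)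

/-- the minimum is ATTAINED on the fibre. [cite: Balaban1985Variational, (161) p.303] -/
theorem exists_dBImin_eq [DecidableEq (BondIdx D)] (dBIt : PBond (cover P jc) 0 → BondIdx (D.comap jc) → ℝ) (b : PBond P 0) (c : BondIdx D) :
    ∃ ct, projIdx D jc ct = c ∧ dBImin D jc dBIt b c = dBIt (liftBond jc b) ct := by
  unfold dBImin
  obtain ⟨ct, hct, h⟩ := Finset.exists_mem_eq_inf' (fibreIdx_nonempty D jc c) fun ct => dBIt (liftBond jc b) ct
  exact ⟨ct, (mem_fibreIdx D jc).1 hct, h⟩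

/-- **`dBImin` DOMINATES THE PHYSICAL DISTANCE DOWNSTAIRS** when `dBĨ` dominates it upstairs: `distBI D b c ≤ dBImin(b, c)` (at the minimiser `c̃*`: `distBI D b c =
distBI D (π b̃₀) (π c̃*) ≤ distBĨ b̃₀ c̃* ≤ dBĨ b̃₀ c̃*`, ✓`distBI_proj_le`). [cite: Balaban1985Variational, (161) p.303; Balaban1984PropagatorsI, (1.110) p.35] -/
theorem distBI_le_dBImin [DecidableEq (BondIdx D)] {dBIt : PBond (cover P jc) 0 → BondIdx (D.comap jc) → ℝ}
    (hdom : ∀ bt ct, distBI (D.comap jc) bt ct ≤ dBIt bt ct) (b : PBond P 0) (c : BondIdx D) : distBI D b c ≤ dBImin D jc dBIt b c := by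
  obtain ⟨ct, hct, h⟩ := exists_dBImin_eq D jc dBIt b c
  rw [h, ← hct]
  have h1 := distBI_proj_le D jc (liftBond jc b) ct
  rw [projBond_liftBond] at h1
  exact h1.trans (hdom _ _)

/-- hence `0 ≤ dBImin`. [cite: Balaban1985Variational, (161) p.303] -/
theorem dBImin_nonneg [DecidableEq (BondIdx D)] {dBIt : PBond (cover P jc) 0 → BondIdx (D.comap jc) → ℝ}
    (hdom : ∀ bt ct, distBI (D.comap jc) bt ct ≤ dBIt bt ct) (b : PBond P 0) (c : BondIdx D) : 0 ≤ dBImin D jc dBIt b c :=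
  (FlatRowsWholeClosed.distBI_nonneg' D b c).trans (distBI_le_dBImin D jc hdom b c)

/-- **THE FIBRE DECAY BOUND**: for `0 ≤ δ₀` and periodic data `X ∘ π`, `Σ_{c̃} e^{−δ₀dBĨ(b̃₀,c̃)}|X(π c̃)| ≤ (L^{jc})^d · Σ_c e^{−δ₀·dBImin(b,c)}|X c|` (regroup over fibres; on the
fibre of `c` every exponential is `≤ e^{−δ₀·min}`; the fibre has `(L^{jc})^d` elements — K-FREE). [cite: Balaban1985Variational, (161) p.303; Balaban1984PropagatorsII, (2.3) p.224] -/
theorem sum_fibre_decay_le [DecidableEq (BondIdx D)] (dBIt : PBond (cover P jc) 0 → BondIdx (D.comap jc) → ℝ) {δ₀ : ℝ} (hδ₀ : 0 ≤ δ₀)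
    (X : BondIdx D → ℝ) (b : PBond P 0) :
    ∑ ct, Real.exp (-(δ₀ * dBIt (liftBond jc b) ct)) * |X (projIdx D jc ct)| ≤
      ((P.L ^ jc) ^ P.d : ℕ) * ∑ c, Real.exp (-(δ₀ * dBImin D jc dBIt b c)) * |X c| := by
  rw [sum_idx_cover_eq_sum_fibre D jc, Finset.mul_sum]
  refine Finset.sum_le_sum fun c _ => ?_
  calc ∑ ct ∈ Finset.univ.filter (fun ct => projIdx D jc ct = c), Real.exp (-(δ₀ * dBIt (liftBond jc b) ct)) * |X (projIdx D jc ct)|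
      ≤ ∑ ct ∈ Finset.univ.filter (fun ct => projIdx D jc ct = c), Real.exp (-(δ₀ * dBImin D jc dBIt b c)) * |X c| := by
        refine Finset.sum_le_sum fun ct hct => ?_
        have hc : projIdx D jc ct = c := (Finset.mem_filter.1 hct).2
        rw [← hc]
        refine mul_le_mul_of_nonneg_right (Real.exp_le_exp.2 ?_) (abs_nonneg _)
        exact neg_le_neg (mul_le_mul_of_nonneg_left (dBImin_le D jc dBIt b ct) hδ₀)
    _ = ((P.L ^ jc) ^ P.d : ℕ) * (Real.exp (-(δ₀ * dBImin D jc dBIt b c)) * |X c|) := by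
        rw [Finset.sum_const, nsmul_eq_mul]
        exact congrArg (fun n : ℕ => (n : ℝ) * _) (card_fibre_idx D jc c)

end Tools

/-! ## §2 ★ The sup letters descend verbatim -/

section Sup

variable (F : T3Family) (n K jc : ℕ) (D : Domains (F.P K))

/-- `π` commutes with `+e_ν` on the fine lattice of the covering MEMBER (✓`proj_shift`, read at `(F.cover jc).P K = cover (F.P K) jc`). [cite: Balaban1987RG1, (0.1) p.251] -/
theorem proj_shift_T3 (x : Site ((F.cover jc).P K) 0) (ν : Fin 3) : proj (F.P K) jc 0 (x.shift ν) = (proj (F.P K) jc 0 x).shift ν :=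
  proj_shift (F.P K) jc 0 x ν

/-- `π` commutes with `−e_ν` on the fine lattice of the covering member (✓`proj_unshift`). [cite: Balaban1987RG1, (0.1) p.251] -/
theorem proj_unshift_T3 (x : Site ((F.cover jc).P K) 0) (ν : Fin 3) : proj (F.P K) jc 0 (x.unshift ν) = (proj (F.P K) jc 0 x).unshift ν :=
  proj_unshift (F.P K) jc 0 x ν

/-- `π` on a bond of the covering member, unfolded. [cite: Balaban1987RG1, (0.1) p.251] -/
theorem projBond_mk_T3 (x : Site ((F.cover jc).P K) 0) (ν : Fin 3) : projBond (F.P K) jc 0 (⟨x, ν⟩ : PBond ((F.cover jc).P K) 0) = ⟨proj (F.P K) jc 0 x, ν⟩ := rfl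

/-- the covering member has the same `L` (as a real number). [cite: Balaban1985Variational, Thm 1 p.279] -/
theorem cover_L_real : ((F.cover jc).L : ℝ) = (F.L : ℝ) := rfl

variable {w : ℕ → PBond (F.P K) 0 → ℝ} {B₀ : ℝ}
variable {H : (BondIdx D → ℝ) →ₗ[ℝ] (PBond (F.P K) 0 → ℝ)} {Ht : (BondIdx (P := (F.cover jc).P K) (D.comap jc) → ℝ) →ₗ[ℝ] (PBond ((F.cover jc).P K) 0 → ℝ)}
variable {Gt : (PBond (F.P K) 0 → ℝ) →ₗ[ℝ] (PBond (F.P K) 0 → ℝ)} {Gtt : (PBond ((F.cover jc).P K) 0 → ℝ) →ₗ[ℝ] (PBond ((F.cover jc).P K) 0 → ℝ)}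

/-- ★ **(46) DESCENDS**: if `H̃` satisfies `HSupLetterG` on the cover with the lifted weights and `H̃ (X ∘ π) = (H X) ∘ π`, then `H` satisfies `HSupLetterG` with the SAME `B₀`
(the level of `π c̃` is the level of `c̃`, so the weighted sup hypothesis lifts; read the conclusion at a lift of `b`, shifts commute with `π`).
[cite: Balaban1985Variational, (46) p.285; Balaban1984PropagatorsII, Cor. 2.8 p.249] -/
theorem hSupLetterG_of_cover (hH : ∀ (X : BondIdx D → ℝ) (bt : PBond ((F.cover jc).P K) 0), Ht (fun ct => X (projIdx D jc ct)) bt = H X (projBond (F.P K) jc 0 bt))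
    (hup : HSupLetterG (F.cover jc) n K (D.comap jc) (fun m bt => w m (projBond (F.P K) jc 0 bt)) Ht B₀) :
    HSupLetterG F n K D w H B₀ := by
  intro X t ht hX
  have hXt : ∀ ct : BondIdx (D.comap jc), ((F.cover jc).L : ℝ) ^ ((ct.1.1 : ℕ)) * (((F.cover jc).L : ℝ)⁻¹) ^ (K - n) * |X (projIdx D jc ct)| ≤ t :=
    fun ct => hX (projIdx D jc ct)
  obtain ⟨h1, h2⟩ := hup (fun ct => X (projIdx D jc ct)) t ht hXt
  refine ⟨fun b => ?_, fun b ν => ?_⟩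
  · set bt : PBond ((F.cover jc).P K) 0 := liftBond jc b
    have hb : projBond (F.P K) jc 0 bt = b := projBond_liftBond jc b
    have := h1 bt
    simp only [hH, hb] at this
    exact this
  · set bt : PBond ((F.cover jc).P K) 0 := liftBond jc b
    have hb : projBond (F.P K) jc 0 bt = b := projBond_liftBond jc b
    have hsrc : proj (F.P K) jc 0 bt.src = b.src := congrArg PBond.src hb
    have hdir : bt.dir = b.dir := congrArg PBond.dir hb
    have := h2 bt ν
    simp only [hH, hb, projBond_mk_T3, proj_shift_T3, hsrc, hdir, cover_L_real] at this
    exact this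

/-- ★ **THE `hG` LETTER DESCENDS**: `GtSupLetterG` for `G̃t` on the cover with the lifted weights and `G̃t (f ∘ π) = (Gt f) ∘ π` gives `GtSupLetterG` for `Gt`, SAME `B₀`.
[cite: Balaban1985Variational, (158) p.302, (165) p.304; Balaban1984PropagatorsII, Prop. 2.2 p.231] -/
theorem gtSupLetterG_of_cover (hGt : ∀ (f : PBond (F.P K) 0 → ℝ) (bt : PBond ((F.cover jc).P K) 0), Gtt (fun bt' => f (projBond (F.P K) jc 0 bt')) bt = Gt f (projBond (F.P K) jc 0 bt))
    (hup : GtSupLetterG (F.cover jc) n K (fun m bt => w m (projBond (F.P K) jc 0 bt)) Gtt B₀) :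
    GtSupLetterG F n K w Gt B₀ := by
  intro f β hβ hf
  obtain ⟨h1, h2⟩ := hup (fun bt' => f (projBond (F.P K) jc 0 bt')) β hβ (fun bt => hf _)
  refine ⟨fun b => ?_, fun b ν => ?_⟩
  · set bt : PBond ((F.cover jc).P K) 0 := liftBond jc b
    have hb : projBond (F.P K) jc 0 bt = b := projBond_liftBond jc b
    have := h1 bt
    simp only [hGt, hb] at this
    exact this
  · set bt : PBond ((F.cover jc).P K) 0 := liftBond jc b
    have hb : projBond (F.P K) jc 0 bt = b := projBond_liftBond jc b
    have hsrc : proj (F.P K) jc 0 bt.src = b.src := congrArg PBond.src hb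
    have hdir : bt.dir = b.dir := congrArg PBond.dir hb
    have := h2 bt ν
    simp only [hGt, hb, projBond_mk_T3, proj_shift_T3, hsrc, hdir, cover_L_real] at this
    exact this

/-- ★ **THE LAPLACIAN LETTER OF (165) DESCENDS**, SAME `B₀` (`±e_ν` shifts commute with `π`). [cite: Balaban1985Variational, (165) p.304; Balaban1984PropagatorsII, Prop. 2.6 (2.136) p.247] -/
theorem gtLaplaceLetterG_of_cover (hGt : ∀ (f : PBond (F.P K) 0 → ℝ) (bt : PBond ((F.cover jc).P K) 0), Gtt (fun bt' => f (projBond (F.P K) jc 0 bt')) bt = Gt f (projBond (F.P K) jc 0 bt))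
    (hup : GtLaplaceLetterG (F.cover jc) n K (fun m bt => w m (projBond (F.P K) jc 0 bt)) Gtt B₀) :
    GtLaplaceLetterG F n K w Gt B₀ := by
  intro f β hβ hf b
  set bt : PBond ((F.cover jc).P K) 0 := liftBond jc b
  have hb : projBond (F.P K) jc 0 bt = b := projBond_liftBond jc b
  have hsrc : proj (F.P K) jc 0 bt.src = b.src := congrArg PBond.src hb
  have hdir : bt.dir = b.dir := congrArg PBond.dir hb
  have := hup (fun bt' => f (projBond (F.P K) jc 0 bt')) β hβ (fun bt => hf _) bt
  simp only [hGt, hb, projBond_mk_T3, proj_shift_T3, proj_unshift_T3, hsrc, hdir, cover_L_real] at this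
  exact this

/-- the guarded (46) letter is monotone in `B₀`. [cite: Balaban1985Variational, (46) p.285] -/
theorem hSupLetterG_mono {B₀ B₀' : ℝ} (hB : B₀ ≤ B₀') (h : HSupLetterG F n K D w H B₀) : HSupLetterG F n K D w H B₀' := by
  intro X t ht hX
  obtain ⟨h1, h2⟩ := h X t ht hX
  exact ⟨fun b => (h1 b).trans (mul_le_mul_of_nonneg_right hB ht), fun b ν => (h2 b ν).trans (mul_le_mul_of_nonneg_right hB ht)⟩

/-- the guarded `hG` letter is monotone in `B₀`. [cite: Balaban1985Variational, (165) p.304] -/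
theorem gtSupLetterG_mono {B₀ B₀' : ℝ} (hB : B₀ ≤ B₀') (h : GtSupLetterG F n K w Gt B₀) : GtSupLetterG F n K w Gt B₀' := by
  intro f β hβ hf
  obtain ⟨h1, h2⟩ := h f β hβ hf
  exact ⟨fun b => (h1 b).trans (mul_le_mul_of_nonneg_right hB hβ), fun b ν => (h2 b ν).trans (mul_le_mul_of_nonneg_right hB hβ)⟩

/-- the guarded Laplacian letter is monotone in `B₀`. [cite: Balaban1985Variational, (165) p.304] -/
theorem gtLaplaceLetterG_mono {B₀ B₀' : ℝ} (hB : B₀ ≤ B₀') (h : GtLaplaceLetterG F n K w Gt B₀) : GtLaplaceLetterG F n K w Gt B₀' :=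
  fun f β hβ hf b => (h f β hβ hf b).trans (mul_le_mul_of_nonneg_right hB hβ)

end Sup

/-! ## §3 ★★ The decaying letters and the (162) row sum descend -/

section Decay

variable (F : T3Family) (n K jc : ℕ) (D : Domains (F.P K)) [DecidableEq (BondIdx D)]
variable {w : ℕ → PBond (F.P K) 0 → ℝ} {B₀ δ₀ B₃ : ℝ}
variable {H : (BondIdx D → ℝ) →ₗ[ℝ] (PBond (F.P K) 0 → ℝ)} {Ht : (BondIdx (P := (F.cover jc).P K) (D.comap jc) → ℝ) →ₗ[ℝ] (PBond ((F.cover jc).P K) 0 → ℝ)}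
variable {dBIt : PBond ((F.cover jc).P K) 0 → BondIdx (P := (F.cover jc).P K) (D.comap jc) → ℝ}

/-- ★★ **(161)₁ DESCENDS WITH `B₀ ↦ B₀·(L^{jc})^d`, SAME `δ₀`, `dBI := dBImin`**: the four rows (value, gradient, `∂*∂`, Laplacian) of `HDecayLetterD` for `H` downstairs from those of
`H̃` upstairs, given the periodisation identities `hH` (and `hdd` for the `∂*∂` row, whose stencil is an adjoint — α3: `∂̃*∂̃(g ∘ π) = (∂*∂g) ∘ π`, stated on any `g̃` agreeing with `g ∘ π` pointwise) and `0 ≤ B₀`, `0 ≤ δ₀`.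
[cite: Balaban1985Variational, (161) p.303; Balaban1984PropagatorsII, Cor. 2.8 (2.150)–(2.151) p.249, (2.3) p.224] -/
theorem hDecayLetterD_of_cover (hB₀ : 0 ≤ B₀) (hδ₀ : 0 ≤ δ₀)
    (hH : ∀ (X : BondIdx D → ℝ) (bt : PBond ((F.cover jc).P K) 0), Ht (fun ct => X (projIdx D jc ct)) bt = H X (projBond (F.P K) jc 0 bt))
    (hdd : ∀ (g : PBond (F.P K) 0 → ℝ) (gt : PBond ((F.cover jc).P K) 0 → ℝ), (∀ bt', gt bt' = g (projBond (F.P K) jc 0 bt')) →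
      ∀ bt : PBond ((F.cover jc).P K) 0,
        (dcsE ((F.L : ℝ) ^ (K - n)) (dcE ((F.L : ℝ) ^ (K - n)) (WithLp.toLp 2 gt))) bt =
          (dcsE ((F.L : ℝ) ^ (K - n)) (dcE ((F.L : ℝ) ^ (K - n)) (WithLp.toLp 2 g))) (projBond (F.P K) jc 0 bt))
    (hup : HDecayLetterD (F.cover jc) n K (D.comap jc) dBIt (fun m bt => w m (projBond (F.P K) jc 0 bt)) Ht B₀ δ₀) :
    HDecayLetterD F n K D (dBImin D jc dBIt) w H (B₀ * ((F.L ^ jc) ^ 3 : ℕ)) δ₀ := by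
  intro X b
  set bt : PBond ((F.cover jc).P K) 0 := liftBond jc b with hbt
  have hb : projBond (F.P K) jc 0 bt = b := projBond_liftBond jc b
  have hsrc : proj (F.P K) jc 0 bt.src = b.src := congrArg PBond.src hb
  have hdir : bt.dir = b.dir := congrArg PBond.dir hb
  -- the common right-hand side: `B₀·Σ_{c̃}(…) ≤ (B₀·(L^{jc})³)·Σ_c(…)`
  have hR := (mul_le_mul_of_nonneg_left (sum_fibre_decay_le D jc dBIt hδ₀ X b) hB₀).trans_eq (mul_assoc _ _ _).symm
  obtain ⟨h1, h2, h3, h4⟩ := hup (fun ct => X (projIdx D jc ct)) bt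
  refine ⟨?_, fun ν => ?_, ?_, ?_⟩
  · simp only [hH, hb] at h1
    exact h1.trans hR
  · have h2ν := h2 ν
    simp only [hH, hb, projBond_mk_T3, proj_shift_T3, hsrc, hdir, cover_L_real] at h2ν
    exact h2ν.trans hR
  · have e := hdd (H X) (Ht fun ct => X (projIdx D jc ct)) (hH X) bt
    simp only [cover_L_real] at h3
    rw [e, hb] at h3
    exact h3.trans hR
  · simp only [hH, hb, projBond_mk_T3, proj_shift_T3, proj_unshift_T3, hsrc, hdir, cover_L_real] at h4
    exact h4.trans hR

/-- ★★ **(162) DESCENDS WITH THE SAME `B₃`** (`dBI := dBImin`): each downstairs summand is the upstairs summand at the minimising lift of its index bond, all summands are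
nonnegative (`dBĨ ≥ distBĨ ≥ 0`), and the weight `w 1 b = w̃ 1 b̃₀ ≥ 0`. [cite: Balaban1985Variational, (162) p.303] -/
theorem rowSum162_of_cover (hw : IsLevWeight F n K D w) (hdom : ∀ bt ct, distBI (D.comap jc) bt ct ≤ dBIt bt ct)
    (hup : RowSum162 (F.cover jc) n K (D.comap jc) dBIt (fun m bt => w m (projBond (F.P K) jc 0 bt)) δ₀ B₃) :
    RowSum162 F n K D (dBImin D jc dBIt) w δ₀ B₃ := by
  intro b
  set bt : PBond ((F.cover jc).P K) 0 := liftBond jc b with hbt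
  have hb : projBond (F.P K) jc 0 bt = b := projBond_liftBond jc b
  have hw0 : 0 ≤ w 1 b := by rw [hw 1 b]; positivity
  -- the upstairs summands are nonnegative
  set st : BondIdx (D.comap jc) → ℝ := fun ct =>
    Real.exp (-(δ₀ / 2 * dBIt bt ct)) * (dBIt bt ct + 1) * ((F.cover jc).L : ℝ) ^ ((K - n) - (ct.1.1 : ℕ)) with hst
  have hst0 : ∀ ct, 0 ≤ st ct := fun ct => by
    have h0 : 0 ≤ dBIt bt ct := (FlatRowsWholeClosed.distBI_nonneg' _ _ _).trans (hdom bt ct)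
    rw [hst]; positivity
  -- each downstairs summand is one upstairs summand of its fibre
  have hsum : ∑ c, Real.exp (-(δ₀ / 2 * dBImin D jc dBIt b c)) * (dBImin D jc dBIt b c + 1) * (F.L : ℝ) ^ ((K - n) - (c.1.1 : ℕ)) ≤ ∑ ct, st ct := by
    rw [sum_idx_cover_eq_sum_fibre D jc st]
    refine Finset.sum_le_sum fun c _ => ?_
    obtain ⟨ct, hct, heq⟩ := exists_dBImin_eq D jc dBIt b c
    have hlev : (c.1.1 : ℕ) = (ct.1.1 : ℕ) := by rw [← hct]; rfl
    calc Real.exp (-(δ₀ / 2 * dBImin D jc dBIt b c)) * (dBImin D jc dBIt b c + 1) * (F.L : ℝ) ^ ((K - n) - (c.1.1 : ℕ)) = st ct := by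
          rw [hst, heq, hlev, hbt]; rfl
      _ ≤ ∑ ct' ∈ Finset.univ.filter (fun ct' => projIdx D jc ct' = projIdx D jc ct), st ct' := le_sum_fibre_of_nonneg D jc st hst0 ct
      _ = ∑ ct' ∈ Finset.univ.filter (fun ct' => projIdx D jc ct' = c), st ct' := by rw [hct]
  have hupb := hup bt
  simp only [hb] at hupb
  exact (mul_le_mul_of_nonneg_left hsum hw0).trans hupb

/-! ## §4 ★★★ The package: the `FlatOpsAdmAtMS`-shaped letters downstairs with the single constant `B₀·(L^{jc})^d` -/

variable {Gt : (PBond (F.P K) 0 → ℝ) →ₗ[ℝ] (PBond (F.P K) 0 → ℝ)} {Gtt : (PBond ((F.cover jc).P K) 0 → ℝ) →ₗ[ℝ] (PBond ((F.cover jc).P K) 0 → ℝ)}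

/-- ★★★ **THE LETTERS OF THE SMALL MEMBER FROM THOSE OF ITS COVER** — the conjunction `body_of_adm22`∕`FlatOpsAdmAtMS` displays (after `IsFlatH ∧ IsFlatGt`), downstairs, with constants
`(B₀·(L^{jc})^3, δ₀, B₃)` and `dBI := dBImin`: from the same conjunction upstairs on `(D.comap jc, w ∘ π)`, the periodisation identities `hH`, `hGt`, `hdd` (α4∕α3 — hypotheses here), the
level weights `w` and `0 ≤ B₀`, `0 ≤ δ₀`.  α6 instantiates `Ht := flatH D̃`, `Gtt := flatGt D̃`, `H := flatH D`, `Gt := flatGt D`.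
[cite: Balaban1985Variational, (46) p.285, (161)–(162) p.303, (165) p.304; Balaban1984PropagatorsII, Cor. 2.8 p.249] -/
theorem lettersMS_of_cover (hw : IsLevWeight F n K D w) (hB₀ : 0 ≤ B₀) (hδ₀ : 0 ≤ δ₀)
    (hH : ∀ (X : BondIdx D → ℝ) (bt : PBond ((F.cover jc).P K) 0), Ht (fun ct => X (projIdx D jc ct)) bt = H X (projBond (F.P K) jc 0 bt))
    (hGt : ∀ (f : PBond (F.P K) 0 → ℝ) (bt : PBond ((F.cover jc).P K) 0), Gtt (fun bt' => f (projBond (F.P K) jc 0 bt')) bt = Gt f (projBond (F.P K) jc 0 bt))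
    (hdd : ∀ (g : PBond (F.P K) 0 → ℝ) (gt : PBond ((F.cover jc).P K) 0 → ℝ), (∀ bt', gt bt' = g (projBond (F.P K) jc 0 bt')) →
      ∀ bt : PBond ((F.cover jc).P K) 0,
        (dcsE ((F.L : ℝ) ^ (K - n)) (dcE ((F.L : ℝ) ^ (K - n)) (WithLp.toLp 2 gt))) bt =
          (dcsE ((F.L : ℝ) ^ (K - n)) (dcE ((F.L : ℝ) ^ (K - n)) (WithLp.toLp 2 g))) (projBond (F.P K) jc 0 bt))
    (h1 : HSupLetterG (F.cover jc) n K (D.comap jc) (fun m bt => w m (projBond (F.P K) jc 0 bt)) Ht B₀)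
    (h2 : GtSupLetterG (F.cover jc) n K (fun m bt => w m (projBond (F.P K) jc 0 bt)) Gtt B₀)
    (h3 : GtLaplaceLetterG (F.cover jc) n K (fun m bt => w m (projBond (F.P K) jc 0 bt)) Gtt B₀)
    (hdom : ∀ bt ct, distBI (D.comap jc) bt ct ≤ dBIt bt ct)
    (h4 : RowSum162 (F.cover jc) n K (D.comap jc) dBIt (fun m bt => w m (projBond (F.P K) jc 0 bt)) δ₀ B₃)
    (h5 : HDecayLetterD (F.cover jc) n K (D.comap jc) dBIt (fun m bt => w m (projBond (F.P K) jc 0 bt)) Ht B₀ δ₀) :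
    HSupLetterG F n K D w H (B₀ * ((F.L ^ jc) ^ 3 : ℕ)) ∧ GtSupLetterG F n K w Gt (B₀ * ((F.L ^ jc) ^ 3 : ℕ)) ∧ GtLaplaceLetterG F n K w Gt (B₀ * ((F.L ^ jc) ^ 3 : ℕ)) ∧
      ∃ dBI : PBond (F.P K) 0 → BondIdx D → ℝ,
        (∀ b c, distBI D b c ≤ dBI b c) ∧ RowSum162 F n K D dBI w δ₀ B₃ ∧ HDecayLetterD F n K D dBI w H (B₀ * ((F.L ^ jc) ^ 3 : ℕ)) δ₀ := by
  have hdeg : B₀ ≤ B₀ * ((F.L ^ jc) ^ 3 : ℕ) := by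
    have h1' : (1 : ℝ) ≤ ((F.L ^ jc) ^ 3 : ℕ) := by
      have hL1 : 1 ≤ F.L := by have := F.hL.2; omega
      exact_mod_cast Nat.one_le_pow _ _ (Nat.pos_iff_ne_zero.2 (pow_ne_zero _ (by omega)))
    nlinarith
  exact ⟨hSupLetterG_mono F n K D hdeg (hSupLetterG_of_cover F n K jc D hH h1), gtSupLetterG_mono F n K hdeg (gtSupLetterG_of_cover F n K jc hGt h2),
    gtLaplaceLetterG_mono F n K hdeg (gtLaplaceLetterG_of_cover F n K jc hGt h3),
    ⟨dBImin D jc dBIt, distBI_le_dBImin D jc hdom, rowSum162_of_cover F n K jc D hw hdom h4, hDecayLetterD_of_cover F n K jc D hB₀ hδ₀ hH hdd h5⟩⟩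

end Decay

end Summit.QuantumFields.YangMills.Theorems.CoverLetters

end
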